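import Summits.ResolutionOfSingularities.ResolutionOfSingularities.Theorems.EquisingularLiftEquisingularLiftNatTowerConeRound
import Summits.ResolutionOfSingularities.ResolutionOfSingularities.Theorems.EquisingularLiftEquisingularLiftNatTowerRuledRoots
import Literature.AlgebraicGeometry.Resolution.StrictTransformBaseChange
import Literature.AlgebraicGeometry.Resolution.BlowupStalkEmbedding
import HarnessLib

/-!
# [OURS · L1 W4.5(b) · EL♮(3)] HSUB′(ReachTower₃) — THE ČECH-WITNESSED ROUND ON `Tower.Inv₂`, NEW EXCEPTIONAL SURFACE `E ↦ υ₂⁻¹Z` — v2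
# (= …NatTowerCechRound p568199 with (N3)'s conditional-regularity clause (k-iv) RE-CUT to the SPECIFIC new sets `E′ := υ₂⁻¹Z`, `K′ := closure υ₂⁻¹(K∖Z)`,
# as res-L1-w45b-stub-2's design note 21:30:50Z requires — the ∀ E′ K″ form of v1 asked unconditional regularity and is not dischargeable)
# (tower driver clause (round), Čech disjunct of `TowerRound₂`; the assembly's stand-in S6 `hCech`, first half; invariants …NatTowerInvDefs v2 at
# `Ruled := DirLift.Ruled`)

res-D-pv-057 g9 AS a w45b hand (res-L1-w45b-plan-1 NAMING 2026-08-27T20:19:01Z «057 → TOWER₃ S6 `hCech` PROOF»; S6 STATEMENT OF RECORD 20:21:03Z (2) =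
res-D-pv-029's `hCech` binder of `D/res-D-pv-029/gen8/TowerAssembly.lean`; custody DEAL #71 (1)). OURS; NOT a statement of any manuscript; AI-written, weaker
than expert review. No `sorry`; standard axioms. DEF-FREE. `--supports stmt-ResolutionOfSingularities-20148 --as helper`. Pattern (E): the file ELABORATES
with NAMED STAND-INS and shrinks as bricks land.

WHAT. `Tower.inv₂_cechRound_new`: at a tower stage `(G, γ, T, E, K)` with `Tower.Inv₂ … (DirLift.Ruled …) …`, a ČECH-WITNESSED round — closed
`Z ⊆ E ∩ T`, nonempty, a full multisection (`TowerFull`), a SECTION over the carrier (`DirStepSec`: `δ : Z̃ ≅ Z̃₉` over `γ ≫ υ'`), `υ₂ : G′ → G` the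
blow-up of `𝓘⟨Z⟩` — yields `Tower.Inv₂` at the new stage `(G′, υ₂ ≫ γ, closure υ₂⁻¹(T ∖ Z), υ₂⁻¹Z, K′)` for the FORGOTTEN shadow `K′ = ∅` and, OFF THE
SHADOW (`closure (Z ∖ closure K) = Z`), for the transported shadow `K′ = closure υ₂⁻¹(K ∖ Z)`, modulo TWO NAMED STAND-INS:
* (N1) `hCentre` — **the ČECH CENTRE at this stage** («T-DIRLIFT at a transported stage», res-L1-w45b-stub-2's S6 design (a)–(d)): from the `Exc₂` datum
  `𝓔` of the stage (exact trace, locally principal, regular, off the generic point of `Y`, `DirLift.Ruled`), an ideal sheaf `𝒦₁` on `X` with the centre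
  `𝒞 := 𝓔 ⊔ 𝒦₁` having (c1) exact reduced trace `𝒞·𝒪_G = 𝓘⟨Z⟩`, (c2) `V(𝒞) → Spec O` flat, (c3) `V(𝒞)` regular, (c4) `𝒦₁|_{V(𝓔)}` effective Cartier
  (the centre is a Cartier divisor ON the surface), (c5) quasi-regular 2-frames of `𝒞` at its points, (c6) `V(𝒞) ≅ ℙ¹_O` over `q` when the carrier is
  certified rational. Dischargers (not in this file): the root of `DirLift.Ruled` + res-D-pv-051's DIRDICT (a) (p555912 / p558327 / p559974) + T-DIRLIFT
  (`directionRoundStep` p556868, D3b p555056, D4 p551347) + stub-2's special-fibre bridge `exists_isIso_redSub_of_iso_over` + T-DIRLIFT-UP (051) +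
  T-CENTRE-2FRAME (stub-3 p564791); `𝒦₁ = C₁·𝒪_X` for the root-level direction centre `C₁`.
* (N3) `hShadow` — **the transported shadow after a Čech round OFF the shadow**: the (k-ii)–(k-vi) clauses of `Tower.Shadow₂` for the pair
  `(𝒞·𝒪_{X₂}, St_𝒞 𝒦)` («simple-root argument on `Γ̃ ∩ V(𝒦)`», …NatTowerInvDefs docstring; owner 051 / stub-2; (k-i) is generic and proved here).
The CONE-WITNESSED sub-case of the driver's `K′` menu is NOT treated here (it is res-D-pv-029's `Tower.inv₂_coneRound_new` p558403); the closer
`…NatTowerCechRoundCloser` dispatches. The OLD surface `closure υ₂⁻¹(E ∖ Z)` is the sequel `…NatTowerCechRoundOld`.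
HOW. res-D-pv-029's `Tower.inv₂_coneRound_new` VERBATIM with the cone partner `𝒦` replaced by (N1)'s `𝒦₁`: `exists_isBlowup` + `modelStep_chain`, (e-i)
…NatExceptionalReducedModel (frames from (c5)), (e-ii) the exceptional divisor is Cartier, (e-iii) Literature `IsBlowup.isRegular_subscheme_comap`, (e-iv)
`𝒞 ≥ 𝓔`, (e-v) DISCHARGED by stub-2's `DirLift.ruled_round_root` (p562947) fed with `DirStepSec`'s `δ` and (c1)–(c6); `K′ = ∅` by `Or.inl`.
-/

set_option linter.dupNamespace false -- mandated namespace `Summit.<Summit>.<Problem>` of this single-conjunct summit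
set_option linter.overlappingInstances false -- signatures carry `[IsDomain O] [IsDiscreteValuationRing O]`

noncomputable section

open CategoryTheory CategoryTheory.Limits AlgebraicGeometry TopologicalSpace Topology IsLocalRing
open Literature.AlgebraicGeometry.Resolution
open Literature.AlgebraicGeometry.Morphisms (ProjCech.PP ProjCech.toSpec)
open AlgebraicGeometry.Scheme.IdealSheafData
open Summit.ResolutionOfSingularities.ResolutionOfSingularities.Theses.EquisingularLift.Split
open Summit.ResolutionOfSingularities.ResolutionOfSingularities.Cruxes.EquisingularLift.StrataSplit

namespace Summit.ResolutionOfSingularities.ResolutionOfSingularities.Cruxes.EquisingularLiftNat.Sections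

set_option maxHeartbeats 800000 in -- one large refine over a 20-clause invariant
/-- **THE ČECH-WITNESSED ROUND on `Tower.Inv₂` (at `Ruled := DirLift.Ruled`), new exceptional surface** (see the module docstring for the two named
stand-ins (N1) `hCentre` and (N3) `hShadow`; everything else is in the tree). [cite: GortzWedhorn2020, (13.19) and Prop. 13.91] [cite: Liu2002, Thm. 8.1.19]
[OURS · L1 W4.5b] clause (round) of the tower driver toward `stub_elnat_coneTowerPointResolution` (stmt-ResolutionOfSingularities-20148 / -20038); NOT a
statement of the manuscript. -/
theorem Tower.inv₂_cechRound_new₂ (O : Type) [CommRing O] [IsDomain O] [IsDiscreteValuationRing O] (k : Type) [Field k]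
    (θ : O →+* k) (hθ : Function.Surjective θ)
    (P : Scheme.{0}) (q : P ⟶ Spec (.of O)) [IsProper q] (Y : Set P) (hYirr : IsIrreducible Y) (hYcl : IsClosed Y)
    (hPnoeth : IsLocallyNoetherian P) (hPreg : Scheme.IsRegular P)
    (Ch : ∀ X' : Scheme.{0}, (X' ⟶ P) → Set X' → Prop)
    (hChain : ∀ (X' : Scheme.{0}) (σ : X' ⟶ P) (S : Set X'), Ch X' σ S → Chain P Y X' σ S)
    (hStep : ∀ (X' X'' : Scheme.{0}) (σ' : X' ⟶ P) (S' : Set X') (C : X'.IdealSheafData) (τ : X'' ⟶ X'),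
      Ch X' σ' S' → IsBlowup τ C → Scheme.IsRegular C.subscheme → Flat (C.subschemeι ≫ σ' ≫ q) →
      σ' '' (C.support : Set X') ⊆ {x : P | ¬ IsGenericPoint x Y} →
      (C.support : Set X') ∩ (σ' ≫ q) ⁻¹' {IsLocalRing.closedPoint O} ⊆ S' →
      Ch X'' (τ ≫ σ') (closure (τ ⁻¹' (S' \ (C.support : Set X')))))
    {F₉ : Scheme.{0}} (Z₉ : Set F₉) (hZ₉ : IsClosed Z₉) {F₁₀ : Scheme.{0}} (υ' : F₁₀ ⟶ F₉)
    (G G' : Scheme.{0}) (γ : G ⟶ F₁₀) (T E K : Set G) (hE : IsClosed E) (Z : Set G) (hZ : IsClosed Z) (υ₂ : G' ⟶ G)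
    (hinv : Tower.Inv₂ O k θ P q Y Ch (DirLift.Ruled O k θ P q Y) F₉ Z₉ hZ₉ F₁₀ υ' G γ T E K)
    (hZET : Z ⊆ E ∩ T) (hfull : TowerFull F₉ F₁₀ υ' Z₉ hZ₉ G γ Z hZ)
    (hsec : DirStepSec F₉ F₁₀ υ' Z₉ hZ₉ G γ Z hZ) (hυ₂ : IsBlowup υ₂ (vanishingIdeal ⟨Z, hZ⟩))
    -- the assembly's downstairs side facts carried next to `Tower.Inv₂`
    (hKcl : IsClosed K) (hKE : K ⊆ closure (K \ E)) (hKne : K ≠ Set.univ)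
    -- (N1) STAND-IN: the ČECH CENTRE `𝒞 = 𝓔 ⊔ 𝒦₁` at this stage (owner res-L1-w45b-stub-2 / res-D-pv-051 / res-L1-w45b-stub-3)
    (hCentre : ∀ (X : Scheme.{0}) (σ : X ⟶ P) (S : Set X) (jG : G ⟶ X) (tG : G ⟶ Spec (.of k)) (𝓔 : X.IdealSheafData),
        Ch X σ S → IsIntegral X → IsLocallyNoetherian X → Scheme.IsRegular X → IsDominant (σ ≫ q) →
        IsPullback jG tG (σ ≫ q) (Spec.map (CommRingCat.ofHom θ)) → jG '' T = S →
        𝓔.comap jG = vanishingIdeal ⟨E, hE⟩ → (∀ z : X, (stalkIdeal 𝓔 z).IsPrincipal) → Scheme.IsRegular 𝓔.subscheme →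
        σ '' (𝓔.support : Set X) ⊆ {p : P | ¬ IsGenericPoint p Y} →
        DirLift.Ruled O k θ P q Y F₉ Z₉ hZ₉ F₁₀ υ' G γ E X σ jG 𝓔 →
        ∃ 𝒦₁ : X.IdealSheafData,
          (𝓔 ⊔ 𝒦₁).comap jG = vanishingIdeal ⟨Z, hZ⟩ ∧ Flat ((𝓔 ⊔ 𝒦₁).subschemeι ≫ σ ≫ q) ∧
          Scheme.IsRegular (𝓔 ⊔ 𝒦₁).subscheme ∧ IsEffectiveCartier (𝒦₁.comap 𝓔.subschemeι) ∧
          (∀ x ∈ (𝓔 ⊔ 𝒦₁).support, ∃ c : Fin 2 → X.presheaf.stalk x,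
            Ideal.span (Set.range c) = stalkIdeal (𝓔 ⊔ 𝒦₁) x ∧ IsQuasiRegular c) ∧
          (RationalCarrier (redSub F₉ Z₉ hZ₉) →
            ∃ e₁ : (𝓔 ⊔ 𝒦₁).subscheme ≅ ProjCech.PP O 1, e₁.hom ≫ ProjCech.toSpec O 1 = (𝓔 ⊔ 𝒦₁).subschemeι ≫ σ ≫ q))
    -- (N3) STAND-IN: the transported shadow after a Čech round OFF the shadow (owner res-D-pv-051 / res-L1-w45b-stub-2)
    (hShadow : ∀ (X : Scheme.{0}) (σ : X ⟶ P) (S : Set X) (jG : G ⟶ X) (tG : G ⟶ Spec (.of k)) (𝓔 𝒦 𝒦₁ : X.IdealSheafData)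
        (X₂ : Scheme.{0}) (τ : X₂ ⟶ X) (j₂ : G' ⟶ X₂) (t₂ : G' ⟶ Spec (.of k)),
        Ch X σ S → IsIntegral X → IsLocallyNoetherian X → Scheme.IsRegular X → IsDominant (σ ≫ q) →
        IsPullback jG tG (σ ≫ q) (Spec.map (CommRingCat.ofHom θ)) → jG '' T = S →
        𝓔.comap jG = vanishingIdeal ⟨E, hE⟩ → (∀ z : X, (stalkIdeal 𝓔 z).IsPrincipal) → Scheme.IsRegular 𝓔.subscheme →
        (∀ z : X, (stalkIdeal 𝒦 z).IsPrincipal) → 𝒦.comap jG = vanishingIdeal (⟨closure K, isClosed_closure⟩ : Closeds G) →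
        Flat ((𝓔 ⊔ 𝒦).subschemeι ≫ σ ≫ q) → IsEffectiveCartier (𝓔.comap 𝒦.subschemeι) → IsEffectiveCartier (𝒦.comap 𝓔.subschemeι) →
        (𝓔 ⊔ 𝒦₁).comap jG = vanishingIdeal ⟨Z, hZ⟩ → Flat ((𝓔 ⊔ 𝒦₁).subschemeι ≫ σ ≫ q) → Scheme.IsRegular (𝓔 ⊔ 𝒦₁).subscheme →
        IsEffectiveCartier (𝒦₁.comap 𝓔.subschemeι) →
        IsBlowup τ (𝓔 ⊔ 𝒦₁) → IsPullback j₂ t₂ ((τ ≫ σ) ≫ q) (Spec.map (CommRingCat.ofHom θ)) → j₂ ≫ τ = υ₂ ≫ jG →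
        IsClosed K → K ⊆ closure (K \ E) → K ≠ Set.univ → closure (Z \ closure K) = Z →
        (strictTransformIdeal τ (𝓔 ⊔ 𝒦₁) 𝒦).comap j₂ =
            vanishingIdeal (⟨closure (closure (υ₂ ⁻¹' (K \ Z))), isClosed_closure⟩ : Closeds G') ∧
          Flat ((((𝓔 ⊔ 𝒦₁).comap τ) ⊔ strictTransformIdeal τ (𝓔 ⊔ 𝒦₁) 𝒦).subschemeι ≫ (τ ≫ σ) ≫ q) ∧
          (∀ (hE' : IsClosed (υ₂ ⁻¹' Z)) (y : G'),
            j₂ y ∈ ((((𝓔 ⊔ 𝒦₁).comap τ) ⊔ strictTransformIdeal τ (𝓔 ⊔ 𝒦₁) 𝒦).support : Set X₂) →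
            stalkIdeal (vanishingIdeal (⟨υ₂ ⁻¹' Z, hE'⟩ : Closeds G') ⊔
              vanishingIdeal (⟨closure (closure (υ₂ ⁻¹' (K \ Z))), isClosed_closure⟩ : Closeds G')) y =
            stalkIdeal (vanishingIdeal (⟨υ₂ ⁻¹' Z ∩ closure (closure (υ₂ ⁻¹' (K \ Z))), hE'.inter isClosed_closure⟩ : Closeds G')) y →
            IsRegularLocalRing (X₂.presheaf.stalk (j₂ y) ⧸
              stalkIdeal (((𝓔 ⊔ 𝒦₁).comap τ) ⊔ strictTransformIdeal τ (𝓔 ⊔ 𝒦₁) 𝒦) (j₂ y))) ∧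
          IsEffectiveCartier (((𝓔 ⊔ 𝒦₁).comap τ).comap (strictTransformIdeal τ (𝓔 ⊔ 𝒦₁) 𝒦).subschemeι) ∧
          IsEffectiveCartier ((strictTransformIdeal τ (𝓔 ⊔ 𝒦₁) 𝒦).comap ((𝓔 ⊔ 𝒦₁).comap τ).subschemeι))
    (K' : Set G') (hK' : K' = ∅ ∨ (closure (Z \ closure K) = Z ∧ K' = closure (υ₂ ⁻¹' (K \ Z)))) :
    Tower.Inv₂ O k θ P q Y Ch (DirLift.Ruled O k θ P q Y) F₉ Z₉ hZ₉ F₁₀ υ' G' (υ₂ ≫ γ) (closure (υ₂ ⁻¹' (T \ Z))) (υ₂ ⁻¹' Z) K' := by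
  classical
  obtain ⟨hυ', hZinf, hGint, hTcl, hTirr, hEcl, hTE₀, X, σ, S, jG, tG, hCh, hXint, hXnoeth, hXreg, hdom, hsq, hTS, hexc⟩ := hinv
  haveI := hGint
  haveI := hXint
  haveI := hXnoeth
  -- the exceptional surface hosts this round, so it is round-ready
  have hZE : Z ⊆ E := fun z hz => (hZET hz).1
  have hZT : Z ⊆ T := fun z hz => (hZET hz).2
  rcases hexc hE with hno | ⟨𝓔, he_i, he_ii, he_iii, he_iv, he_v, hshadow⟩
  · exact absurd hfull (Tower.not_towerFull_of_noRound υ' Z₉ hZ₉ hZinf G γ E hno Z hZ hZE)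
  -- the section isomorphism of the round
  obtain ⟨δ, hδ, hδiso⟩ := hsec
  haveI := hδiso
  -- (N1) the Čech centre `𝒞 = 𝓔 ⊔ 𝒦₁`
  obtain ⟨𝒦₁, hc1, hc2, hc3, hc4, hc5, hc6⟩ :=
    hCentre X σ S jG tG 𝓔 hCh hXint hXnoeth hXreg hdom hsq hTS he_i he_ii he_iii he_iv he_v
  -- properness of the stage; the model square
  obtain ⟨-, -, hσ⟩ := chain_isRegular P Y X σ S (hChain _ _ _ hCh) hPnoeth hPreg
  haveI := hσ
  haveI : IsProper (σ ≫ q) := inferInstance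
  haveI : IsClosedImmersion (Spec.map (CommRingCat.ofHom θ)) := IsClosedImmersion.spec_of_surjective _ hθ
  haveI hjci : IsClosedImmersion jG := MorphismProperty.IsStableUnderBaseChange.of_isPullback hsq.flip inferInstance
  -- the centre is off the generic point of `Y` (it lies on `V(𝓔)`)
  have hiv : σ '' ((𝓔 ⊔ 𝒦₁).support : Set X) ⊆ {p : P | ¬ IsGenericPoint p Y} := by
    rintro _ ⟨x, hx, rfl⟩
    exact he_iv ⟨x, Scheme.IdealSheafData.support_antitone le_sup_left hx, rfl⟩
  -- support bookkeeping downstairs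
  have hsuppZ : ((vanishingIdeal ⟨Z, hZ⟩ : G.IdealSheafData).support : Set G) = Z := Scheme.IdealSheafData.coe_support_vanishingIdeal _
  have hDT : ((vanishingIdeal ⟨Z, hZ⟩ : G.IdealSheafData).support : Set G) ⊆ T := by rw [hsuppZ]; exact hZT
  have hTZ : ¬ T ⊆ Z := fun h => hTE₀ (h.trans hZE)
  have hTD : ¬ T ⊆ ((vanishingIdeal ⟨Z, hZ⟩ : G.IdealSheafData).support : Set G) := by rw [hsuppZ]; exact hTZ
  -- blow up the centre and run the model step
  obtain ⟨X₂, τ, hτ⟩ := exists_isBlowup X (𝓔 ⊔ 𝒦₁)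
  obtain ⟨hint₂, hnoeth₂, hreg₂, hdom₂, hF₂, hirr, j₂, t₂, hsq₂, hcomm, hCh₂⟩ :=
    modelStep_chain O k θ hθ P q Y hYirr hYcl Ch hChain hStep X σ S hCh hXreg hdom G jG tG hsq T hTS (𝓔 ⊔ 𝒦₁)
      (vanishingIdeal ⟨Z, hZ⟩) hc1 hc3 hc2 hiv hDT hTD X₂ τ hτ G' υ₂ hυ₂
  rw [hsuppZ] at hirr hCh₂
  haveI := hint₂
  haveI := hnoeth₂
  haveI := hF₂
  haveI : IsProper τ := hτ.isProper
  -- a point of `G'` off the exceptional surface, `T' ⊄ E'`, the centre is non-zero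
  obtain ⟨t, htT, htE⟩ := Set.not_subset.mp hTE₀
  have htZ : t ∉ Z := fun h => htE (hZE h)
  obtain ⟨t', ht'⟩ := hυ₂.exists_preimage_of_not_mem_support (z := t) (by rw [hsuppZ]; exact htZ)
  have hTE : ¬ closure (υ₂ ⁻¹' (T \ Z)) ⊆ υ₂ ⁻¹' Z := by
    intro h
    have h1 : t' ∈ closure (υ₂ ⁻¹' (T \ Z)) := subset_closure (show υ₂ t' ∈ T \ Z by rw [ht']; exact ⟨htT, htZ⟩)
    have h2 : υ₂ t' ∈ Z := h h1
    rw [ht'] at h2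
    exact htZ h2
  have hCne : 𝓔 ⊔ 𝒦₁ ≠ ⊥ := by
    rintro hbot
    obtain ⟨u, hu, hKu⟩ := hτ.isEffectiveCartier.exists_stalkIdeal_eq_span (j₂ t')
    rw [hbot, Scheme.IdealSheafData.comap_bot, stalkIdeal_bot, eq_comm, Ideal.span_singleton_eq_bot] at hKu
    rw [hKu] at hu
    exact zero_notMem_nonZeroDivisors hu
  -- quasi-regular frames of the centre at the points over `Z` ((c5))
  have hqr : ∀ z ∈ ((⟨Z, hZ⟩ : Closeds G) : Set G), ∃ (n : ℕ) (c : Fin n → X.presheaf.stalk (jG z)),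
      Ideal.span (Set.range c) = stalkIdeal (𝓔 ⊔ 𝒦₁) (jG z) ∧ IsQuasiRegular c := by
    intro z hz
    have hzC : jG z ∈ ((𝓔 ⊔ 𝒦₁).support : Set X) := by
      have h1 : z ∈ (((𝓔 ⊔ 𝒦₁).comap jG).support : Set G) := by rw [hc1, hsuppZ]; exact hz
      rw [Scheme.IdealSheafData.support_comap] at h1
      exact h1
    obtain ⟨c, hc, hq⟩ := hc5 (jG z) hzC
    exact ⟨2, c, hc, hq⟩
  -- (e-i)…(e-iv) for the new exceptional surface `𝓔' := 𝒞·𝒪_{X₂}`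
  have he1 : ((𝓔 ⊔ 𝒦₁).comap τ).comap j₂ = vanishingIdeal ⟨υ₂ ⁻¹' Z, hZ.preimage υ₂.continuous⟩ :=
    comap_comap_eq_vanishingIdeal_preimage_of_model O k θ hθ (σ ≫ q) jG tG hsq (𝓔 ⊔ 𝒦₁) τ hτ j₂ t₂
      (by simpa only [Category.assoc] using hsq₂) υ₂ hcomm ⟨Z, hZ⟩ hc1 hqr
  have he2 : ∀ z : X₂, (stalkIdeal ((𝓔 ⊔ 𝒦₁).comap τ) z).IsPrincipal := fun z => by
    obtain ⟨u, -, hu⟩ := hτ.isEffectiveCartier.exists_stalkIdeal_eq_span z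
    exact ⟨⟨u, by rw [hu, Ideal.submodule_span_eq]⟩⟩
  have he3 : Scheme.IsRegular ((𝓔 ⊔ 𝒦₁).comap τ).subscheme := hτ.isRegular_subscheme_comap hXreg hc3
  have he4 : (τ ≫ σ) '' (((𝓔 ⊔ 𝒦₁).comap τ).support : Set X₂) ⊆ {p : P | ¬ IsGenericPoint p Y} := by
    rintro _ ⟨z, hz, rfl⟩
    rw [Scheme.IdealSheafData.support_comap] at hz
    exact hiv ⟨τ z, hz, rfl⟩
  -- (e-v) the ruled-surface datum of the new surface is BORN here (stub-2's `ruled_round_root` with `DirStepSec`'s `δ` and (c1)–(c6))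
  have he5 : DirLift.Ruled O k θ P q Y F₉ Z₉ hZ₉ F₁₀ υ' G' (υ₂ ≫ γ) (υ₂ ⁻¹' Z) X₂ (τ ≫ σ) j₂ ((𝓔 ⊔ 𝒦₁).comap τ) :=
    DirLift.ruled_round_root γ Z hZ υ₂ hυ₂ δ hδ X σ jG tG (𝓔 ⊔ 𝒦₁) X₂ τ j₂ t₂ hXreg hsq hc1 hc2 hc3 hτ hsq₂ hcomm hiv hc5 hc6 (υ₂ ⁻¹' Z)
  -- (k-i) for the transported shadow is generic
  have hk1 : ∀ (𝒦 : X.IdealSheafData), (∀ z : X, (stalkIdeal 𝒦 z).IsPrincipal) →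
      ∀ z : X₂, (stalkIdeal (strictTransformIdeal τ (𝓔 ⊔ 𝒦₁) 𝒦) z).IsPrincipal := fun 𝒦 h𝒦 z =>
    isPrincipal_stalkIdeal_strictTransformIdeal hXreg hc3 hτ hCne 𝒦 h𝒦 z
  -- assemble
  refine ⟨hυ', hZinf, hF₂, isClosed_closure, hirr, hZ.preimage υ₂.continuous, hTE, X₂, τ ≫ σ, _, j₂, t₂, hCh₂, hint₂, hnoeth₂,
    hreg₂, hdom₂, hsq₂, rfl, fun hE' => Or.inr ⟨(𝓔 ⊔ 𝒦₁).comap τ, he1, he2, he3, he4, he5, ?_⟩⟩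
  rcases hK' with hK' | ⟨hoff, hK'⟩
  · exact Or.inl hK'
  · subst hK'
    -- the shadow: forgotten upstairs (`K = ∅`, then `K′ = ∅`) or transported by (N3)
    rcases hshadow with hK0 | ⟨𝒦, hk_i, hk_ii, hk_iii, hk_iv, hk_v, hk_vi⟩
    · left
      subst hK0
      simp only [Set.empty_sdiff, Set.preimage_empty, closure_empty]
    · right
      obtain ⟨hs2, hs3, hs4, hs5, hs6⟩ := hShadow X σ S jG tG 𝓔 𝒦 𝒦₁ X₂ τ j₂ t₂ hCh hXint hXnoeth hXreg hdom hsq hTS he_i he_ii he_iii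
        hk_i hk_ii hk_iii hk_v hk_vi hc1 hc2 hc3 hc4 hτ hsq₂ hcomm hKcl hKE hKne hoff
      exact ⟨_, hk1 𝒦 hk_i, hs2, hs3, hs4 hE', hs5, hs6⟩

end Summit.ResolutionOfSingularities.ResolutionOfSingularities.Cruxes.EquisingularLiftNat.Sections

end
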